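import Literature.AlgebraicGeometry.Motives.TateAbelianLatticeOfEllPowerTowerProofs
import Literature.AlgebraicGeometry.Motives.FaltingsAbelianOfTateSubspaceRealizationProofs
import HarnessLib

/-!
# Tate's finiteness hypothesis along ℓ-power towers, as a NAMED PREDICATE, and [Fal83 §5 Kor. 1] from it

The junction of the (T5) line `Cruxes/HLiu418/Lines/faltings_isogeny.lean` (cell hodgecm-mathlib), moved to
Literature so that Theorems files (the floor `HCCMUnconditionalOfFloorPart2`, the a3 registry) can key the
Faltings citation (row VI-1) on it BY NAME: `AbelianVariety.tateHypEllPowerTower P ℓ` — Tate, Invent. Math. 2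
(1966), §2, Hyp(k, A, d, ℓ), p. 136, clause (b) «there exists a k-isogeny B → A of l-power degree», without the
polarisation clause, in the sequence form consumed by `tateSubspaceRealization_of_ellPowerTower` — together with
(i) `tateHypEllPowerTower_of_finite_isoClasses_isogenous` (it is implied by Finiteness I, Milne IV 1.1: the
re-keyed citation is WEAKER than [Fal83 §6]), and (ii) the sorry-free composition
`faltings_tate_bijective_of_tateHypEllPowerTower`: Hyp for `(A ⊞ B) ⊞ (A ⊞ B)` ⟹ the Tate map
`ℤ_ℓ ⊗ Hom_K(A, B) → Hom_{Γ_K}(T_ℓ A, T_ℓ B)` is bijective ([Fal83] §5 Satz 4 + Kor. 1 exactly as printed: Thm 1 +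
Thm 2 deliver Hyp along the ℓ-power tower, Tate's argument does the rest —
`tateSubspaceRealization_of_ellPowerTower_numberField` ★, `faltings_tate_bijective_of_tateSubspaceRealization` ★).
This is a definition + two theorems; the OPEN printed input ([Fal83] Thm 1 + Thm 2, heights on moduli) is NOT
stated here as a fact — it stays the registered stub `stub_hypEllPowerTower` of the crux workfile until a height
predicate for abelian varieties exists (FALTINGS-SPEC §6.3).
-/

noncomputable section

open CategoryTheory CategoryTheory.Limits

universe u

namespace Literature.AlgebraicGeometry.Motives

namespace AbelianVariety

variable {K : Type u} [Field K]

/-- **Tate's finiteness hypothesis along ℓ-power towers** (Tate 1966 §2 Hyp(k, A, d, ℓ), p. 136, clause (b),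
without the polarisation clause; Milne, *Abelian Varieties*, IV §2, the condition used in the proof of Lemma 2.4):
over a number field, for every tower of isogenies `f n : B n ⟶ P`, `h n : P ⟶ B n` with `h n ≫ f n = ℓⁿ • 𝟙 P`
and `f n ≫ h n = ℓⁿ • 𝟙 (B n)`, infinitely many `B n` are mutually isomorphic.  Text = the hypothesis `htower` of
`tateSubspaceRealization_of_ellPowerTower_numberField` under `∀ [NumberField K]`.
[cite: Tate1966Endomorphisms, §2 Hyp(k,A,d,l), p. 136] [cite: MilneAV2008, Ch. IV §2, proof of Lemma 2.4] -/
def tateHypEllPowerTower (P : AbelianVariety K) (ℓ : ℕ) : Prop :=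
  ∀ [NumberField K], ∀ (B : ℕ → AbelianVariety K) (f : ∀ n, B n ⟶ P) (h : ∀ n, P ⟶ B n),
    (∀ n, IsIsogeny (f n)) → (∀ n, IsIsogeny (h n)) → (∀ n, h n ≫ f n = (ℓ ^ n) • 𝟙 P) →
    (∀ n, f n ≫ h n = (ℓ ^ n) • 𝟙 (B n)) →
    ∃ S : Set ℕ, S.Infinite ∧ ∀ m ∈ S, ∀ n ∈ S, Nonempty (B m ≅ B n)

/-- Finiteness I (`finite_isoClasses_isogenous P`, [Fal83 §6] / Milne IV Thm 1.1) implies Tate's hypothesis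
along ℓ-power towers — pigeonhole on the finitely many isomorphism classes
(`finite_isoClasses_isogenous.exists_infinite_setOf_iso`).  The re-keyed citation is the weaker one.
[cite: MilneAV2008, Ch. IV, proof of Lemma 2.4, p. 137] -/
theorem tateHypEllPowerTower_of_finite_isoClasses_isogenous (P : AbelianVariety K) (ℓ : ℕ)
    (hfin : finite_isoClasses_isogenous P) :
    tateHypEllPowerTower P ℓ := by
  intro _ B f h hf _ _ _
  exact hfin.exists_infinite_setOf_iso B fun n ↦ ⟨f n, hf n⟩

/-- **Tate's lattice lemma from the hypothesis, over a number field** — by name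
`tateSubspaceRealization_of_ellPowerTower_numberField`. [cite: Tate1966Endomorphisms, §2 Prop. 1]
[cite: Faltings1983Endlichkeit, §5 (proof of Satz 3–4, first paragraph)] -/
theorem tateSubspaceRealization_of_tateHypEllPowerTower (P : AbelianVariety K) (ℓ : ℕ) [Fact ℓ.Prime] [NumberField K]
    (h : tateHypEllPowerTower P ℓ) : tateSubspaceRealization P ℓ :=
  tateSubspaceRealization_of_ellPowerTower_numberField P ℓ h

end AbelianVariety

/-- **[Faltings 1983, §5 Korollar 1] from Tate's hypothesis along ℓ-power towers for `(A ⊞ B) ⊞ (A ⊞ B)`**: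
for abelian varieties `A, B` over a number field and a prime `ℓ`, if Hyp holds for `(A ⊞ B) ⊞ (A ⊞ B)` (which is
what [Fal83] Thm 1 + Thm 2 give along the towers of §5 ¶1), then the Tate map
`ℤ_ℓ ⊗ Hom_K(A, B) → Hom_{ℤ_ℓ[Γ_K]}(T_ℓ A, T_ℓ B)` is bijective (`faltings_tate_bijective A B ℓ`) — Tate's lattice
lemma (`AbelianVariety.tateSubspaceRealization_of_tateHypEllPowerTower`) followed by Tate's argument with Zarhin's
corner trick (`faltings_tate_bijective_of_tateSubspaceRealization`).  Sorry-free; the open printed input is the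
hypothesis. [cite: Faltings1983Endlichkeit, §5 Satz 4 and Korollar 1] [cite: Tate1966Endomorphisms, §2 Prop. 1–2] -/
theorem faltings_tate_bijective_of_tateHypEllPowerTower {K : Type u} [Field K] (A B : AbelianVariety K)
    (ℓ : ℕ) [Fact ℓ.Prime] (h : AbelianVariety.tateHypEllPowerTower ((A ⊞ B) ⊞ (A ⊞ B)) ℓ) :
    faltings_tate_bijective A B ℓ := by
  intro hK
  have hb : faltings_tate_bijective A B ℓ :=
    faltings_tate_bijective_of_tateSubspaceRealization A B ℓ
      (AbelianVariety.tateSubspaceRealization_of_tateHypEllPowerTower _ ℓ h)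
  exact hb

/-- **Row VI-1 of the cell's floor in Tate's-hypothesis currency**: Hyp along ℓ-power towers for every abelian
variety over every number field implies `faltings_tate_bijective A B ℓ` for all pairs — the form a floor edition
keys the Faltings citation on ([Fal83 Thm 1 + Thm 2] instead of Kor. 1; strength-down, print-toward).
[cite: Faltings1983Endlichkeit, §3 Satz 1, §4 Satz 2, §5 Korollar 1] -/
theorem faltings_tate_bijective_of_forall_tateHypEllPowerTower
    (h : ∀ {K : Type u} [Field K] [NumberField K] (P : AbelianVariety K) (ℓ : ℕ) [Fact ℓ.Prime],
      AbelianVariety.tateHypEllPowerTower P ℓ)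
    {K : Type u} [Field K] (A B : AbelianVariety K) (ℓ : ℕ) [Fact ℓ.Prime] :
    faltings_tate_bijective A B ℓ := by
  intro hK
  have hb : faltings_tate_bijective A B ℓ := faltings_tate_bijective_of_tateHypEllPowerTower A B ℓ (h _ ℓ)
  exact hb

end Literature.AlgebraicGeometry.Motives

end
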